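import Summits.BirchSwinnertonDyer.BirchSwinnertonDyer.Theorems.ByReductionTypeAtTwoRankOneAtTwoBigImageOddLocalOneDoorHalvesNamed
import Summits.BirchSwinnertonDyer.BirchSwinnertonDyer.Theorems.ByReductionTypeAtTwoRankOneAtTwoBigImageOddLocalOneDoorHalvesAssembly
import HarnessLib

/-!
# Route ByReductionTypeAtTwo, crux `RankOneAtTwoBigImageOddLocal` (stmt-BirchSwinnertonDyer-23715), LINE v8.6 `one_door_analytic`:
# the crux IS the conjunction of the two named halves (modulo the four primary facts and the route's rank-`0` cruxes)

Lead prover seat `bsd-line-fkl-p1` g8 (2026-08-28), `--supports stmt-BirchSwinnertonDyer-23715`.  THEOREMS ONLY; conditional by design;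
BSD is not proved by any of this.  Capstone of the v8.6 HALVES reshape (`…OneDoorLawCDefs.lean` APPEND #6 p626076,
`…OneDoorHalvesBookkeeping.lean` p627433, `…OneDoorHalvesAssembly.lean` p628086, `…OneDoorHalvesNamed.lean` p628851, over the width seat
fkl-p2 g8's `…OneDoorValuation.lean` / `…OneDoorHalves.lean` / `…OneDoorHalvesSlice.lean`):

* `halves_of_rankOneAtTwoBigImageOddLocal` — **the crux ⟹ AN-28c-U ∧ AN-28c-L** (modulo `gross_zagier`, `kolyvagin`, `exists_isNewformOf`,
  Hoffstein–Luo 1997 and `S_rankZeroTwin`): `BSD(W,2)` on the slice gives Miller's two halves (`bsdp_two_iff_halves_of_rankOne`; rank and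
  finiteness from the four facts), which give back the named halves at every door datum (`…_of_missingUpperBoundAt_onSlice` /
  `…_of_missingLowerBoundAt_onSlice`).
* **`rankOneAtTwoBigImageOddLocal_iff_halves`** — modulo the four primary printed facts and the route's four rank-`0` cruxes at `2`,
  **`RankOneAtTwoBigImageOddLocal ↔ DoorIndexLawUpperCAtTwo ∧ DoorIndexLawLowerCAtTwo`**: the skeleton v8.6 is LOSSLESS — its two
  conjecture stubs carry exactly the content of the crux, no more (each is implied by the crux) and no less (together they give it).

So the open content of 23715 is, by name and in the kernel: Kolyvagin's upper bound with the exact power of `2` (U) and the rank-one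
`2`-converse direction (L), for big-image curves with odd local terms; everything else on the line is print or the route's own rank-`0` items.

References: [GrossLMS1991] Thm. 1.3, §2 Conj. (2.2); [Miller2011LMS] Def. 1.1.
-/

set_option autoImplicit false

noncomputable section

open scoped Classical

set_option linter.dupNamespace false

namespace Summit.BirchSwinnertonDyer.BirchSwinnertonDyer.Theorems.RankOneAtTwoOneDoor

open WeierstrassCurve NumberField IsDedekindDomain Rat.HeightOneSpectrum Literature.NumberTheory.EllipticCurves
  Literature.NumberTheory.EllipticCurves.ModularForms
  Literature.NumberTheory.EllipticCurves.KrizLi2019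
  Literature.NumberTheory.EllipticCurves.Rank1Residual.Typed
  Summit.BirchSwinnertonDyer.Rank1Residual.F1Sign2
  Summit.BirchSwinnertonDyer.Rank1Residual.F1Sign2.TranspositionDoor
  Summit.BirchSwinnertonDyer.Rank1Residual
  Summit.BirchSwinnertonDyer.BirchSwinnertonDyer.Theses.ByReductionTypeAtTwo

/-- **The crux ⟹ both named halves** (modulo the four primary facts and `S_rankZeroTwin`): `BSD(W,2)` for every `W` on the slice gives
Miller's lower and upper halves on the slice (`bsdp_two_iff_halves_of_rankOne`, with `rank E(ℚ) = 1` and `Ш(W)` finite from Gross–Zagier,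
Kolyvagin, modularity, Hoffstein–Luo), and those give AN-28c-U / AN-28c-L at every door datum and every exponent
(`doorIndexLawUpperCAtTwo_of_missingUpperBoundAt_onSlice`, `doorIndexLawLowerCAtTwo_of_missingLowerBoundAt_onSlice`). Conditional by design.
[cite: GrossLMS1991, Thm. 1.3 and §2 Conj. (2.2)] [cite: Miller2011LMS, Def. 1.1] -/
theorem halves_of_rankOneAtTwoBigImageOddLocal
    (hGZ : ∀ (N : ℕ) [NeZero N] (W : WeierstrassCurve ℚ) (K : Type) [Field K] [NumberField K], gross_zagier N W K)
    (hKo : ∀ (N : ℕ) [NeZero N] (W : WeierstrassCurve ℚ) (K : Type) [Field K] [NumberField K], kolyvagin N W K)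
    (hnf : exists_isNewformOf) (hHL : HoffsteinLuo1997_exists_twist_L_one_ne_zero) (hZ : S_rankZeroTwin)
    (h : RankOneAtTwoBigImageOddLocal) : DoorIndexLawUpperCAtTwo ∧ DoorIndexLawLowerCAtTwo := by
  have hboth : ∀ (W : WeierstrassCurve ℚ) [W.IsElliptic] [W.IsGloballyMinimal], ¬ W.HasCM →
      (∀ n : ℕ, W.HasSurjectiveModNGaloisRep ((2 ^ n : ℕ) : ℤ)) → Odd W.torsionOrder → Odd W.tamagawaProduct →
      W.analyticRank = 1 → MissingLowerBoundAt W 2 ∧ MissingUpperBoundAt W 2 := by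
    intro W _ _ hCM hsurj hT hc hr
    obtain ⟨hrk, hfin⟩ := mordellWeilRank_eq_one_of_analyticRank_eq_one_of_isGloballyMinimal hGZ hKo hnf hHL W hr
    exact (bsdp_two_iff_halves_of_rankOne W hr hrk hfin).mp (h W hCM hsurj hT hc hr)
  exact ⟨doorIndexLawUpperCAtTwo_of_missingUpperBoundAt_onSlice hGZ hKo hnf hHL
      (fun W _ _ hCM hsurj hT hc hr => (hboth W hCM hsurj hT hc hr).2) hZ,
    doorIndexLawLowerCAtTwo_of_missingLowerBoundAt_onSlice hGZ hKo hnf hHL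
      (fun W _ _ hCM hsurj hT hc hr => (hboth W hCM hsurj hT hc hr).1) hZ⟩

/-- **THE CRUX IS THE CONJUNCTION OF ITS TWO NAMED HALVES** — modulo the four primary printed facts (`gross_zagier`, `kolyvagin`,
`exists_isNewformOf`, Hoffstein–Luo 1997) and the route's four rank-`0` cruxes at `2` BY NAME:
`RankOneAtTwoBigImageOddLocal ↔ DoorIndexLawUpperCAtTwo ∧ DoorIndexLawLowerCAtTwo`.  (`→`: `halves_of_rankOneAtTwoBigImageOddLocal` with
`S_rankZeroTwin` from the four items; `←`: the skeleton's composition `rankOneAtTwoBigImageOddLocal_of_oneDoorAnalyticC_halves`.)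
Conditional by design; BSD is not proved by this. [cite: GrossLMS1991, §2 Conj. (2.2)] [cite: Miller2011LMS, Def. 1.1] -/
theorem rankOneAtTwoBigImageOddLocal_iff_halves
    (hGZ : ∀ (N : ℕ) [NeZero N] (W : WeierstrassCurve ℚ) (K : Type) [Field K] [NumberField K], gross_zagier N W K)
    (hKo : ∀ (N : ℕ) [NeZero N] (W : WeierstrassCurve ℚ) (K : Type) [Field K] [NumberField K], kolyvagin N W K)
    (hnf : exists_isNewformOf) (hHL : HoffsteinLuo1997_exists_twist_L_one_ne_zero)
    (hZ4 : GoodOrdinaryRankZeroAtTwo ∧ MultiplicativeRankZeroAtTwo ∧ SupersingularRankZeroAtTwo ∧ AdditiveRankZeroAtTwo) :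
    RankOneAtTwoBigImageOddLocal ↔ DoorIndexLawUpperCAtTwo ∧ DoorIndexLawLowerCAtTwo := by
  have hZ : S_rankZeroTwin := fun V _ _ hVCM hV0 => bsdp_two_of_rankZero_cruxes hZ4 V hVCM hV0
  exact ⟨halves_of_rankOneAtTwoBigImageOddLocal hGZ hKo hnf hHL hZ,
    fun hUL => rankOneAtTwoBigImageOddLocal_of_oneDoorAnalyticC_halves hGZ hKo hnf hHL hUL.1 hUL.2 hZ4⟩

end Summit.BirchSwinnertonDyer.BirchSwinnertonDyer.Theorems.RankOneAtTwoOneDoor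

end
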